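import Summits.CriticalPhenomena.PercolationContinuityZ3.Theorems.FK.InfiniteVolumeDLRAutomorphism
import Literature.Probability.LatticeModels.ThermodynamicLimit
import HarnessLib

/-!
# FK-continuity transplant, FO-10 (infinite-volume structure): translates and Cesàro averages of finite measures with
# the one-edge conditional probabilities — the tools of Grimmett 2006, Thm. (4.33)(a) (a translation-invariant limit point)

Registered R103 (cell INBOX l.7022, 2026-08-24); registry row FO-10b-g412; label DRE-D1 (coordinator fk-4 g216).
Cell `fk-continuity` (bschramm), FO-10b lineage; support file for the FK-continuity transplant
(`--supports stmt-CriticalPhenomena-4575`); builds on p205010 (kernel theorem, internal audit signed; external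
expert review pending). CONDITIONAL cell (FH AND TP_FK open at the same `p` for `q > 1`; K1); the transplant is a
typed reduction, not a proof of FK continuity — this file is UNCONDITIONAL infinite-volume structure for general `d`;
no defs, no named facts, no sorries, standard axioms; NOT a binder discharge, NOT `_r4`; `_r3` « 2 / 0 ☑ »
unchanged, n_open = 2.

## What this file proves

Grimmett 2006, Thm. (4.33)(a) ("The closed convex hull of `W_{p,q}` contains some translation-invariant probability
measure") is proved by Cesàro-averaging the translates of finite-volume random-cluster measures over boxes and passing
to a limit point. This file supplies the measure-theoretic and combinatorial tools; the limit is taken in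
`InfiniteVolumeDLRExistenceInvariant.lean`:

* `real_edgeOpen_inter_preimage_eq_map_relabel` — TRANSPORT of the one-edge conditional probabilities (4.38): if the
  finite measure `ν` has (4.38) at the edge `φ⁻¹ e` then `ν ∘ τ_φ⁻¹` has (4.38) at `e` (`τ_φ = BondConfig.relabel (sym2Equiv φ)`;
  the transport identities of `InfiniteVolumeDLRAutomorphism.lean`);
* `preimage_relabel_shift_preimage_relabel_shift` — `τ_w ∘ τ_v = τ_{v+w}` (in preimage form);
* `real_edgeOpen_inter_preimage_eq_smul_sum` — (4.38) at `e` is a LINEAR identity: it passes to `c • ∑_{i ∈ B} μ_i`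
  (Cesàro averages, finite convex combinations — the "co" of `co W_{p,q}`); `measureReal_smul_sum` — the real-valued
  evaluation `(c • ∑ μ_i)(S) = c · ∑ μ_i(S)`;
* `abs_sum_sub_sum_le_card_sdiff` — `|∑_{s} f - ∑_{t} f| ≤ #(s ∖ t) + #(t ∖ s)` for `0 ≤ f ≤ 1`;
* `card_box_sdiff_image_add_le`, `card_image_add_box_sdiff_le` — a box and its translate by
  `w ∈ Λ_k` differ by at most `(2n+1)^d - (2(n-k)+1)^d` sites each way;
* `abs_sum_box_comp_add_sub_sum_box_le` — hence `|∑_{v ∈ Λ_n} f(v + w) - ∑_{v ∈ Λ_n} f(v)| ≤ 2((2n+1)^d - (2(n-k)+1)^d)`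
  for `0 ≤ f ≤ 1`: the Cesàro averages are asymptotically translation invariant;
* `tendsto_one_sub_ratio_pow` — `2 (1 - ((2(n-k)+1)/(2n+1))^d) → 0`.

## References

* G. Grimmett, *The Random-Cluster Model*, Springer 2006: Thm. (4.33)(a) and its proof (p. 82, [152]), Thm. (4.19)(b).
  [Grimmett2006]
-/

noncomputable section

open MeasureTheory Filter Set

open scoped Topology ENNReal

namespace Summit.CriticalPhenomena.PercolationContinuityZ3.Theorems.FK

open Literature.Probability.Percolation Literature.Probability.LatticeModels

variable {d : ℕ}

/-! ### Transport of the one-edge conditional probabilities under a relabelling -/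

section Transport

variable {p q : ℝ} {ν : Measure (BondConfig (Site d))}

/-- **Transport of (4.38)**: if the finite measure `ν` has the one-edge conditional probabilities (4.38) at the edge
`⟨φ⁻¹ x, φ⁻¹ y⟩`, then the image measure `ν ∘ τ_φ⁻¹` has them at `⟨x, y⟩`. [cite: Grimmett2006, Thm. (4.19)(b), Prop. (4.37)(a) eq. (4.38)] -/
theorem real_edgeOpen_inter_preimage_eq_map_relabel [IsFiniteMeasure ν] (φ : Site d ≃ Site d) {x y : Site d}
    (hE : ∀ ⦃H₀ : Set (BondConfig (Site d))⦄, MeasurableSet H₀ →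
      ν.real ({ω | s(φ.symm x, φ.symm y) ∈ ω} ∩ (fun η => η \ {s(φ.symm x, φ.symm y)}) ⁻¹' H₀) =
        p * ν.real ((fun η => η \ {s(φ.symm x, φ.symm y)}) ⁻¹' (H₀ ∩ openConn (φ.symm x) (φ.symm y))) +
          p / (p + q * (1 - p)) *
            ν.real ((fun η => η \ {s(φ.symm x, φ.symm y)}) ⁻¹' (H₀ ∩ (openConn (φ.symm x) (φ.symm y))ᶜ)))
    {H₀ : Set (BondConfig (Site d))} (hH₀ : MeasurableSet H₀) :
    (ν.map ⇑(BondConfig.relabel (sym2Equiv φ))).real ({ω | s(x, y) ∈ ω} ∩ (fun η => η \ {s(x, y)}) ⁻¹' H₀) =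
      p * (ν.map ⇑(BondConfig.relabel (sym2Equiv φ))).real ((fun η => η \ {s(x, y)}) ⁻¹' (H₀ ∩ openConn x y)) +
        p / (p + q * (1 - p)) *
          (ν.map ⇑(BondConfig.relabel (sym2Equiv φ))).real ((fun η => η \ {s(x, y)}) ⁻¹' (H₀ ∩ (openConn x y)ᶜ)) := by
  have hτ : Measurable ⇑(BondConfig.relabel (sym2Equiv φ)) := (BondConfig.relabel _).measurable
  have hcl : ∀ u v : Site d, Measurable fun η : BondConfig (Site d) => η \ {s(u, v)} := fun u v =>
    measurable_closeEdges _
  have hmap : ∀ {S : Set (BondConfig (Site d))}, MeasurableSet S →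
      (ν.map ⇑(BondConfig.relabel (sym2Equiv φ))).real S = ν.real (⇑(BondConfig.relabel (sym2Equiv φ)) ⁻¹' S) := by
    intro S hS
    rw [measureReal_def, measureReal_def, Measure.map_apply hτ hS]
  have hK : MeasurableSet (openConn x y : Set (BondConfig (Site d))) := measurableSet_openConn_holds x y
  have h1 : ⇑(BondConfig.relabel (sym2Equiv φ)) ⁻¹' ({ω | s(x, y) ∈ ω} ∩ (fun η => η \ {s(x, y)}) ⁻¹' H₀) =
      {ω | s(φ.symm x, φ.symm y) ∈ ω} ∩ (fun η => η \ {s(φ.symm x, φ.symm y)}) ⁻¹'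
        (⇑(BondConfig.relabel (sym2Equiv φ)) ⁻¹' H₀) := by
    rw [Set.preimage_inter, relabel_preimage_setOf_mk_mem, relabel_preimage_closeEdges_preimage]
  have h2 : ⇑(BondConfig.relabel (sym2Equiv φ)) ⁻¹' ((fun η => η \ {s(x, y)}) ⁻¹' (H₀ ∩ openConn x y)) =
      (fun η => η \ {s(φ.symm x, φ.symm y)}) ⁻¹'
        (⇑(BondConfig.relabel (sym2Equiv φ)) ⁻¹' H₀ ∩ openConn (φ.symm x) (φ.symm y)) := by
    rw [relabel_preimage_closeEdges_preimage, Set.preimage_inter, relabel_preimage_openConn]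
  have h3 : ⇑(BondConfig.relabel (sym2Equiv φ)) ⁻¹' ((fun η => η \ {s(x, y)}) ⁻¹' (H₀ ∩ (openConn x y)ᶜ)) =
      (fun η => η \ {s(φ.symm x, φ.symm y)}) ⁻¹'
        (⇑(BondConfig.relabel (sym2Equiv φ)) ⁻¹' H₀ ∩ (openConn (φ.symm x) (φ.symm y))ᶜ) := by
    rw [relabel_preimage_closeEdges_preimage, Set.preimage_inter, Set.preimage_compl, relabel_preimage_openConn]
  rw [hmap ((measurableSet_mem _).inter (hH₀.preimage (hcl x y))), hmap ((hH₀.inter hK).preimage (hcl x y)),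
    hmap ((hH₀.inter hK.compl).preimage (hcl x y)), h1, h2, h3]
  exact hE (hH₀.preimage hτ)

/-- `τ_v⁻¹ (τ_w⁻¹ A) = τ_{v+w}⁻¹ A`. [folklore] -/
theorem preimage_relabel_shift_preimage_relabel_shift (v w : Site d) (A : Set (BondConfig (Site d))) :
    ⇑(BondConfig.relabel (sym2Equiv (Site.shift v))) ⁻¹' (⇑(BondConfig.relabel (sym2Equiv (Site.shift w))) ⁻¹' A) =
      ⇑(BondConfig.relabel (sym2Equiv (Site.shift (v + w)))) ⁻¹' A := by
  -- `τ_w (τ_v ω) = τ_{v+w} ω` (the tree's `…Theorems.Crossing.relabel_shift_relabel_shift`, route-local; inlined here)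
  have hcomp : ∀ ω : BondConfig (Site d), BondConfig.relabel (sym2Equiv (Site.shift w))
      (BondConfig.relabel (sym2Equiv (Site.shift v)) ω) = BondConfig.relabel (sym2Equiv (Site.shift (v + w))) ω := by
    intro ω
    ext z
    simp only [BondConfig.mem_relabel_iff, sym2Equiv_symm, sym2Equiv_apply, Sym2.map_map]
    induction z using Sym2.ind with
    | _ a b =>
      simp only [Sym2.map_mk, Function.comp_apply, Site.shift_symm_apply, sub_sub, add_comm w v]
  ext ω
  simp only [Set.mem_preimage, hcomp]

end Transport

/-! ### The one-edge identity is linear in the measure -/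

section Linear

variable {ι : Type*} {p q : ℝ}

/-- `(c • ∑_{i ∈ B} μ_i)(S) = c · ∑_{i ∈ B} μ_i(S)` on real numbers, for finite measures and `c ≠ ∞`. [folklore] -/
theorem measureReal_smul_sum (B : Finset ι) (μ : ι → Measure (BondConfig (Site d))) [∀ i, IsFiniteMeasure (μ i)]
    {c : ℝ≥0∞} (S : Set (BondConfig (Site d))) :
    (c • ∑ i ∈ B, μ i).real S = c.toReal * ∑ i ∈ B, (μ i).real S := by
  rw [measureReal_def, Measure.smul_apply, smul_eq_mul, ENNReal.toReal_mul, Measure.coe_finsetSum,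
    Finset.sum_apply, ENNReal.toReal_sum fun i _ => measure_ne_top _ _]
  rfl

/-- **(4.38) is linear**: if every `μ_i`, `i ∈ B`, has the one-edge conditional probabilities (4.38) at `⟨x, y⟩`, so has
`c • ∑_{i ∈ B} μ_i` (finite convex combinations, Cesàro averages). [cite: Grimmett2006, Thm. (4.34)(a) (convexity), Prop. (4.37)] -/
theorem real_edgeOpen_inter_preimage_eq_smul_sum (B : Finset ι) (μ : ι → Measure (BondConfig (Site d)))
    [∀ i, IsFiniteMeasure (μ i)] (c : ℝ≥0∞) {x y : Site d}
    (hE : ∀ i ∈ B, ∀ ⦃H₀ : Set (BondConfig (Site d))⦄, MeasurableSet H₀ →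
      (μ i).real ({ω | s(x, y) ∈ ω} ∩ (fun η => η \ {s(x, y)}) ⁻¹' H₀) =
        p * (μ i).real ((fun η => η \ {s(x, y)}) ⁻¹' (H₀ ∩ openConn x y)) +
          p / (p + q * (1 - p)) * (μ i).real ((fun η => η \ {s(x, y)}) ⁻¹' (H₀ ∩ (openConn x y)ᶜ)))
    {H₀ : Set (BondConfig (Site d))} (hH₀ : MeasurableSet H₀) :
    (c • ∑ i ∈ B, μ i).real ({ω | s(x, y) ∈ ω} ∩ (fun η => η \ {s(x, y)}) ⁻¹' H₀) =
      p * (c • ∑ i ∈ B, μ i).real ((fun η => η \ {s(x, y)}) ⁻¹' (H₀ ∩ openConn x y)) +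
        p / (p + q * (1 - p)) * (c • ∑ i ∈ B, μ i).real ((fun η => η \ {s(x, y)}) ⁻¹' (H₀ ∩ (openConn x y)ᶜ)) := by
  rw [measureReal_smul_sum, measureReal_smul_sum, measureReal_smul_sum, Finset.sum_congr rfl fun i hi => hE i hi hH₀,
    Finset.sum_add_distrib, ← Finset.mul_sum, ← Finset.mul_sum]
  ring

end Linear

/-! ### Boxes and their translates -/

section Boxes

/-- `|∑_{s} f - ∑_{t} f| ≤ #(s ∖ t) + #(t ∖ s)` for `0 ≤ f ≤ 1`. [folklore] -/
theorem abs_sum_sub_sum_le_card_sdiff {ι : Type*} [DecidableEq ι] (s t : Finset ι) {f : ι → ℝ}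
    (h0 : ∀ i, 0 ≤ f i) (h1 : ∀ i, f i ≤ 1) :
    |∑ i ∈ s, f i - ∑ i ∈ t, f i| ≤ ((s \ t).card + (t \ s).card : ℝ) := by
  have hs : ∑ i ∈ s, f i = ∑ i ∈ s \ t, f i + ∑ i ∈ s ∩ t, f i := by
    rw [← Finset.sum_sdiff Finset.inter_subset_left, Finset.sdiff_inter_self_left]
  have ht : ∑ i ∈ t, f i = ∑ i ∈ t \ s, f i + ∑ i ∈ s ∩ t, f i := by
    rw [← Finset.sum_sdiff Finset.inter_subset_right, Finset.sdiff_inter_self_right]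
  have hA : ∑ i ∈ s \ t, f i ≤ ((s \ t).card : ℝ) := by
    have := Finset.sum_le_card_nsmul (s \ t) f 1 fun i _ => h1 i
    simpa using this
  have hB : ∑ i ∈ t \ s, f i ≤ ((t \ s).card : ℝ) := by
    have := Finset.sum_le_card_nsmul (t \ s) f 1 fun i _ => h1 i
    simpa using this
  have hA0 : 0 ≤ ∑ i ∈ s \ t, f i := Finset.sum_nonneg fun i _ => h0 i
  have hB0 : 0 ≤ ∑ i ∈ t \ s, f i := Finset.sum_nonneg fun i _ => h0 i
  rw [hs, ht, abs_le]
  constructor <;> linarith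

/-- The translate `Λ_{n-k} + w` (`w ∈ Λ_k`, `k ≤ n`) lies in `Λ_n ∩ (Λ_n + w)`, so `#(Λ_n ∖ (Λ_n + w)) ≤ (2n+1)^d - (2(n-k)+1)^d`.
[folklore] -/
theorem card_box_sdiff_image_add_le {n k : ℕ} (hk : k ≤ n) {w : Site d} (hw : w ∈ box d k) :
    ((box d n \ (box d n).image fun x => x + w).card : ℝ) ≤ (2 * n + 1 : ℝ) ^ d - (2 * (n - k) + 1 : ℝ) ^ d := by
  classical
  set s : Finset (Site d) := (box d n).image fun x => x + w with hs
  have hsub : ((box d (n - k)).image fun x => x + w) ⊆ box d n ∩ s := by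
    intro u hu
    obtain ⟨x, hx, rfl⟩ := Finset.mem_image.1 hu
    refine Finset.mem_inter.2 ⟨?_, Finset.mem_image.2 ⟨x, box_mono d (Nat.sub_le n k) hx, rfl⟩⟩
    have : x + w ∈ box d (n - k + k) := by
      rw [mem_box] at hx hw ⊢
      intro i
      have h1 := hx i
      have h2 := hw i
      simp only [Pi.add_apply, Nat.cast_add]
      constructor <;> linarith [h1.1, h1.2, h2.1, h2.2]
    rwa [Nat.sub_add_cancel hk] at this
  have hinj : Function.Injective fun x : Site d => x + w := fun a b h => add_right_cancel h
  have hcard : ((2 * (n - k) + 1) ^ d : ℕ) ≤ (box d n ∩ s).card := by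
    rw [← card_box d (n - k), ← Finset.card_image_of_injective (box d (n - k)) hinj]
    exact Finset.card_le_card hsub
  have hsplit := Finset.card_sdiff_add_card_inter (box d n) s
  rw [card_box] at hsplit
  have h' : ((box d n \ s).card : ℝ) = ((2 * n + 1) ^ d : ℕ) - ((box d n ∩ s).card : ℝ) := by
    have := congrArg (fun m : ℕ => (m : ℝ)) hsplit
    push_cast at this ⊢
    linarith
  rw [h']
  have hc : ((2 * (n - k) + 1 : ℕ) : ℝ) ^ d ≤ ((box d n ∩ s).card : ℝ) := by exact_mod_cast hcard
  push_cast [Nat.cast_sub hk] at hc ⊢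
  linarith

/-- Symmetrically `#((Λ_n + w) ∖ Λ_n) ≤ (2n+1)^d - (2(n-k)+1)^d`. [folklore] -/
theorem card_image_add_box_sdiff_le {n k : ℕ} (hk : k ≤ n) {w : Site d} (hw : w ∈ box d k) :
    ((((box d n).image fun x => x + w) \ box d n).card : ℝ) ≤ (2 * n + 1 : ℝ) ^ d - (2 * (n - k) + 1 : ℝ) ^ d := by
  classical
  set s : Finset (Site d) := (box d n).image fun x => x + w with hs
  have hinj : Function.Injective fun x : Site d => x + w := fun a b h => add_right_cancel h
  have hsub : ((box d (n - k)).image fun x => x + w) ⊆ s ∩ box d n := by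
    intro u hu
    obtain ⟨x, hx, rfl⟩ := Finset.mem_image.1 hu
    refine Finset.mem_inter.2 ⟨Finset.mem_image.2 ⟨x, box_mono d (Nat.sub_le n k) hx, rfl⟩, ?_⟩
    have : x + w ∈ box d (n - k + k) := by
      rw [mem_box] at hx hw ⊢
      intro i
      have h1 := hx i
      have h2 := hw i
      simp only [Pi.add_apply, Nat.cast_add]
      constructor <;> linarith [h1.1, h1.2, h2.1, h2.2]
    rwa [Nat.sub_add_cancel hk] at this
  have hcard : ((2 * (n - k) + 1) ^ d : ℕ) ≤ (s ∩ box d n).card := by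
    rw [← card_box d (n - k), ← Finset.card_image_of_injective (box d (n - k)) hinj]
    exact Finset.card_le_card hsub
  have hscard : s.card = (2 * n + 1) ^ d := by rw [hs, Finset.card_image_of_injective _ hinj, card_box]
  have hsplit := Finset.card_sdiff_add_card_inter s (box d n)
  rw [hscard] at hsplit
  have h' : ((s \ box d n).card : ℝ) = ((2 * n + 1) ^ d : ℕ) - ((s ∩ box d n).card : ℝ) := by
    have := congrArg (fun m : ℕ => (m : ℝ)) hsplit
    push_cast at this ⊢
    linarith
  rw [h']
  have hc : ((2 * (n - k) + 1 : ℕ) : ℝ) ^ d ≤ ((s ∩ box d n).card : ℝ) := by exact_mod_cast hcard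
  push_cast [Nat.cast_sub hk] at hc ⊢
  linarith

/-- **Cesàro averages over boxes are asymptotically translation invariant**: for `0 ≤ f ≤ 1`, `w ∈ Λ_k`, `k ≤ n`,
`|∑_{v ∈ Λ_n} f(v + w) - ∑_{v ∈ Λ_n} f(v)| ≤ 2((2n+1)^d - (2(n-k)+1)^d)`. [cite: Grimmett2006, Thm. (4.33)(a) (proof)] -/
theorem abs_sum_box_comp_add_sub_sum_box_le {n k : ℕ} (hk : k ≤ n) {w : Site d} (hw : w ∈ box d k) {f : Site d → ℝ}
    (h0 : ∀ v, 0 ≤ f v) (h1 : ∀ v, f v ≤ 1) :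
    |∑ v ∈ box d n, f (v + w) - ∑ v ∈ box d n, f v| ≤ 2 * ((2 * n + 1 : ℝ) ^ d - (2 * (n - k) + 1 : ℝ) ^ d) := by
  classical
  have hinj : Function.Injective fun x : Site d => x + w := fun a b h => add_right_cancel h
  have hsum : ∑ v ∈ box d n, f (v + w) = ∑ u ∈ (box d n).image fun x => x + w, f u := by
    rw [Finset.sum_image fun a _ b _ h => hinj h]
  rw [hsum]
  refine (abs_sum_sub_sum_le_card_sdiff _ _ h0 h1).trans ?_
  linarith [card_image_add_box_sdiff_le (d := d) hk hw, card_box_sdiff_image_add_le (d := d) hk hw]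

/-- `2 (1 - ((2(n-k)+1)/(2n+1))^d) → 0` as `n → ∞`. [folklore] -/
theorem tendsto_one_sub_ratio_pow (d k : ℕ) :
    Tendsto (fun n : ℕ => 2 * (1 - ((2 * (n - k) + 1 : ℝ) / (2 * n + 1)) ^ d)) atTop (𝓝 0) := by
  have hlim : Tendsto (fun n : ℕ => (2 * (n - k) + 1 : ℝ) / (2 * n + 1)) atTop (𝓝 1) := by
    have heq : (fun n : ℕ => (2 * (n - k) + 1 : ℝ) / (2 * n + 1)) =ᶠ[atTop]
        fun n : ℕ => 1 - (2 * k : ℝ) / (2 * n + 1) := by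
      refine Filter.Eventually.of_forall fun n => ?_
      have hpos : (0 : ℝ) < 2 * n + 1 := by positivity
      field_simp
      ring
    refine Tendsto.congr' heq.symm ?_
    have h0 : Tendsto (fun n : ℕ => (2 * k : ℝ) / (2 * n + 1)) atTop (𝓝 0) := by
      refine tendsto_const_nhds.div_atTop ?_
      exact tendsto_atTop_add_const_right _ 1
        (Tendsto.const_mul_atTop (by norm_num : (0 : ℝ) < 2) tendsto_natCast_atTop_atTop)
    simpa using (tendsto_const_nhds (x := (1 : ℝ))).sub h0
  have h2 := (hlim.pow d)
  rw [one_pow] at h2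
  have h3 := ((tendsto_const_nhds (x := (1 : ℝ))).sub h2).const_mul 2
  simpa using h3

end Boxes

end Summit.CriticalPhenomena.PercolationContinuityZ3.Theorems.FK

end
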